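import Literature.Combinatorics.SimpleGraph.GridFormulaCount
import HarnessLib

/-!
# The grid graph of a formula, made explicit: vertex, slot and edge lists

Geometry-independent half of the grid drawing `E₀` of the grid-native `#3SAT ≤ #HamPath`
construction `Literature.Combinatorics.SimpleGraph.GridFormula.graphOf ψ` (`GridFormulaCells.lean`,
`GridFormulaGadgets.lean`, `GridFormulaCount.lean`; Liśkiewicz–Ogihara–Toda 2003, Lemma 4 /
Theorem 7, tree fact `GridSAW.LOT2003_lemma4_gadgets`). The graph `graphOf ψ` is defined through
the iterated substitution `GadgetFamily.graphUpTo` of placed rail gadgets (`RailPlacement`) into the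
chain of cells; a grid drawing and the polynomial-time machine both need it as FINITE LISTS of
numbered vertices and edges. This file provides them and proves that they describe `graphOf ψ`:

* for any placed rail gadget `P : RailPlacement`: `rpVerts P`, `rpSlots P`, `rpEdges P` (through
  the arithmetic forms `rpEdgesN`, `railEdgesN`) with `mem_rpVerts_iff` (`v ∈ P.VX`),
  `mem_rpSlots_iff` (`e ∈ P.S`) and **`gx_adj_iff`** (`P.GX.Adj a b ↔ (a, b)` or `(b, a)` listed);
* for the chain of cells: `chainVertsN ψ`, `chainEdgesN ψ` with `mem_chainVertsN_iff`,
  **`chainG_adj_iff_mem`**;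
* for the whole graph: `placeVerts/placeSlots/placeEdges ψ g`, `slotsOf ψ`, **`vertsListOf ψ`**,
  **`edgesOf ψ`** with **`mem_vertsOf_iff`** (`a ∈ vertsOf ψ ↔ a ∈ vertsListOf ψ`) and
  **`graphOf_adj_iff`** (`(graphOf ψ).Adj a b ↔ (a, b) ∈ edgesOf ψ ∨ (b, a) ∈ edgesOf ψ`);
* the arithmetic of the three placed templates (`rpEdges` of an XOR-chord, a one-input and a
  three-input OR-gadget as explicit lists: `placeEdges_eq`, `placeVerts_eq`, `placeSlots_eq`),
  the input of the typed-polynomial-time machine of the sequel.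

## References

* M. Liśkiewicz, M. Ogihara, S. Toda, TCS 304 (2003) 129–156, §3 (proof of Lemma 4), §4 (proof
  of Theorem 7: the embedding `E₀`).
* M. R. Garey, D. S. Johnson, *Computers and Intractability*, Freeman 1979, §3.2.2.
-/

namespace Literature.Barriers.CriticalPhenomena.GridSAW

namespace GridFormulaFP

open Literature.Computability.Complexity (CNF)
open Literature.Combinatorics.SimpleGraph Literature.Combinatorics.SimpleGraph.GridFormula
open Literature.Combinatorics.SimpleGraph.GridFormula.Slot
open Literature.Combinatorics.SimpleGraph.GridCell (CellTy conn vtx chainG chainVerts cellTy)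
open Literature.Combinatorics.SimpleGraph.RailV

/-! ### Placed rail gadgets as lists -/

section RailPlacementLists

open Literature.Combinatorics.SimpleGraph.RailPlacement

/-- **The edges of one placed rail**, rail `r` of `K` nodes numbered `base + r K, …, base + r K + K - 1`
between the slot ends `u` (at node `0`) and `v` (at node `K - 1`): the port edge `(u, node 0)`, the
rail edges `(node i, node (i+1))`, and the port edge `(v, node (K-1))`. [folklore] -/
def railEdgesN (K base u v r : ℕ) : List (ℕ × ℕ) :=
  (u, base + r * K) :: ((List.range (K - 1)).map fun i => (base + r * K + i, base + r * K + (i + 1))) ++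
    [(v, base + r * K + (K - 1))]

/-- **The edges of a placed rail gadget, arithmetically**: `k` rails of `K` nodes from `base` on with
slot ends `ends r`, then for each of the `m` rungs (midpoint `base + k K + ρ`) its two halves to the
nodes with codes `fstC ρ`, `sndC ρ`. [folklore] -/
def rpEdgesN (k K m base : ℕ) (ends : ℕ → ℕ × ℕ) (fstC sndC : ℕ → ℕ) : List (ℕ × ℕ) :=
  (List.range k).flatMap (fun r => railEdgesN K base (ends r).1 (ends r).2 r) ++
    (List.range m).flatMap fun ρ => [(base + (k * K + ρ), base + fstC ρ), (base + (k * K + ρ), base + sndC ρ)]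

variable (P : RailPlacement)

/-- The slot ends of a placement as a total function. [folklore] -/
def endsN (r : ℕ) : ℕ × ℕ := if h : r < P.k then P.ends ⟨r, h⟩ else (0, 0)

/-- The code `r K + i` of the first end of rung `ρ` (total function). [folklore] -/
def fstN (ρ : ℕ) : ℕ := if h : ρ < P.m then (P.Γ.fst ⟨ρ, h⟩).1.val * P.K + (P.Γ.fst ⟨ρ, h⟩).2.val else 0

/-- The code `r K + i` of the second end of rung `ρ` (total function). [folklore] -/
def sndN (ρ : ℕ) : ℕ := if h : ρ < P.m then (P.Γ.snd ⟨ρ, h⟩).1.val * P.K + (P.Γ.snd ⟨ρ, h⟩).2.val else 0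

/-- **The edge list of a placed rail gadget.** [folklore] -/
def rpEdges : List (ℕ × ℕ) := rpEdgesN P.k P.K P.m P.base (endsN P) (fstN P) (sndN P)

/-- **The vertex list of a placed rail gadget**: the block `base, …, base + k K + m - 1`. [folklore] -/
def rpVerts : List ℕ := (List.range (P.k * P.K + P.m)).map fun i => P.base + i

/-- **The slot list of a placed rail gadget.** [folklore] -/
def rpSlots : List (ℕ × ℕ) := (List.range P.k).map (endsN P)

/-- `endsN` on a rail index. [folklore] -/
theorem endsN_eq (r : Fin P.k) : endsN P r.val = P.ends r := by
  unfold endsN; rw [dif_pos r.isLt]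

/-- `fstN` on a rung index. [folklore] -/
theorem fstN_eq (ρ : Fin P.m) : fstN P ρ.val = (P.Γ.fst ρ).1.val * P.K + (P.Γ.fst ρ).2.val := by
  unfold fstN; rw [dif_pos ρ.isLt]

/-- `sndN` on a rung index. [folklore] -/
theorem sndN_eq (ρ : Fin P.m) : sndN P ρ.val = (P.Γ.snd ρ).1.val * P.K + (P.Γ.snd ρ).2.val := by
  unfold sndN; rw [dif_pos ρ.isLt]

/-- **Membership in the slot list** is membership in `P.S`. [folklore] -/
theorem mem_rpSlots_iff {e : ℕ × ℕ} : e ∈ rpSlots P ↔ e ∈ P.S := by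
  rw [rpSlots, List.mem_map, P.mem_S_iff]
  constructor
  · rintro ⟨r, hr, rfl⟩
    rw [List.mem_range] at hr
    exact ⟨⟨r, hr⟩, endsN_eq P ⟨r, hr⟩⟩
  · rintro ⟨r, rfl⟩
    exact ⟨r.val, List.mem_range.2 r.isLt, endsN_eq P r⟩

/-- **Membership in the vertex list** is membership in `P.VX`: the block of `k K + m` numbers from
`base`. [folklore] -/
theorem mem_rpVerts_iff {v : ℕ} : v ∈ rpVerts P ↔ v ∈ P.VX := by
  rw [rpVerts, List.mem_map]
  constructor
  · rintro ⟨i, hi, rfl⟩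
    rw [List.mem_range] at hi
    have hK : 0 < P.K := P.Γ.pos
    by_cases hn : i < P.k * P.K
    · -- a rail node
      have hr : i / P.K < P.k := (Nat.div_lt_iff_lt_mul hK).2 hn
      have hc : i % P.K < P.K := Nat.mod_lt _ hK
      have : P.emb (node (⟨i / P.K, hr⟩, ⟨i % P.K, hc⟩)) = P.base + i := by
        simp only [emb_apply, RailPlacement.embFun]
        congr 1
        exact Nat.div_add_mod' i P.K
      rw [← this]
      exact P.emb_mem_VX rfl
    · -- a midpoint
      have hρ : i - P.k * P.K < P.m := by omega
      have : P.emb (mid ⟨i - P.k * P.K, hρ⟩) = P.base + i := by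
        simp only [emb_apply, RailPlacement.embFun]
        omega
      rw [← this]
      exact P.emb_mem_VX rfl
  · intro hv
    obtain ⟨h1, h2⟩ := P.mem_VX_bounds hv
    exact ⟨v - P.base, List.mem_range.2 (by omega), by omega⟩

/-- The vertex list has no repeats. [folklore] -/
theorem rpVerts_nodup : (rpVerts P).Nodup :=
  (List.nodup_range).map fun _ _ h => by simpa using h

/-- Members of `railEdgesN`. [folklore] -/
theorem mem_railEdgesN_iff {K base u v r : ℕ} {e : ℕ × ℕ} :
    e ∈ railEdgesN K base u v r ↔
      e = (u, base + r * K) ∨ (∃ i, i + 1 < K ∧ e = (base + r * K + i, base + r * K + (i + 1))) ∨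
        e = (v, base + r * K + (K - 1)) := by
  unfold railEdgesN
  simp only [List.mem_cons, List.mem_append, List.mem_map, List.mem_range, List.not_mem_nil, or_false]
  constructor
  · rintro ((h | ⟨i, hi, rfl⟩) | h)
    · exact Or.inl h
    · exact Or.inr (Or.inl ⟨i, by omega, rfl⟩)
    · exact Or.inr (Or.inr h)
  · rintro (h | ⟨i, hi, rfl⟩ | h)
    · exact Or.inl (Or.inl h)
    · exact Or.inl (Or.inr ⟨i, by omega, rfl⟩)
    · exact Or.inr h

/-- Members of `rpEdgesN`. [folklore] -/
theorem mem_rpEdgesN_iff {k K m base : ℕ} {ends : ℕ → ℕ × ℕ} {fstC sndC : ℕ → ℕ} {e : ℕ × ℕ} :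
    e ∈ rpEdgesN k K m base ends fstC sndC ↔
      (∃ r < k, e ∈ railEdgesN K base (ends r).1 (ends r).2 r) ∨
        (∃ ρ < m, e = (base + (k * K + ρ), base + fstC ρ) ∨ e = (base + (k * K + ρ), base + sndC ρ)) := by
  unfold rpEdgesN
  simp only [List.mem_append, List.mem_flatMap, List.mem_range, List.mem_cons, List.not_mem_nil, or_false]

/-- **The edge relation of the template, numbered, is membership in the edge list.** [folklore] -/
theorem relB_iff_mem_rpEdges {a b : ℕ} :
    (∃ u v, P.Γ.relB u v = true ∧ P.embFun u = a ∧ P.embFun v = b) ↔ (a, b) ∈ rpEdges P := by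
  have hK1 : 1 < P.K := P.Γ.one_lt
  rw [rpEdges, mem_rpEdgesN_iff]
  constructor
  · rintro ⟨u, v, huv, rfl, rfl⟩
    cases u with
    | node x =>
      cases v with
      | node y =>
        -- consecutive rail nodes
        simp only [RailGadget.relB, Bool.and_eq_true, beq_iff_eq] at huv
        obtain ⟨h1, h2⟩ := huv
        refine Or.inl ⟨x.1.val, x.1.isLt, mem_railEdgesN_iff.2 (Or.inr (Or.inl ⟨x.2.val, by have := y.2.isLt; omega, ?_⟩))⟩
        simp only [RailPlacement.embFun, ← h1, h2, Prod.mk.injEq]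
        constructor <;> ring
      | mid ρ => simp [RailGadget.relB] at huv
      | port r t => cases t <;> simp [RailGadget.relB] at huv
    | mid ρ =>
      cases v with
      | node x =>
        simp only [RailGadget.relB, Bool.or_eq_true, beq_iff_eq] at huv
        refine Or.inr ⟨ρ.val, ρ.isLt, ?_⟩
        rcases huv with h | h
        · left
          simp only [RailPlacement.embFun, fstN_eq, h]
        · right
          simp only [RailPlacement.embFun, sndN_eq, h]
      | mid ρ' => simp [RailGadget.relB] at huv
      | port r t => cases t <;> simp [RailGadget.relB] at huv
    | port r t =>
      cases v with
      | node x =>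
        cases t with
        | true =>
          simp only [RailGadget.relB, Bool.and_eq_true, beq_iff_eq] at huv
          obtain ⟨h1, h2⟩ := huv
          refine Or.inl ⟨r.val, r.isLt, mem_railEdgesN_iff.2 (Or.inl ?_)⟩
          simp only [RailPlacement.embFun, endsN_eq, ← h1, h2, add_zero]
        | false =>
          simp only [RailGadget.relB, Bool.and_eq_true, beq_iff_eq] at huv
          obtain ⟨h1, h2⟩ := huv
          refine Or.inl ⟨r.val, r.isLt, mem_railEdgesN_iff.2 (Or.inr (Or.inr ?_))⟩
          simp only [RailPlacement.embFun, endsN_eq, ← h1, Prod.mk.injEq, true_and]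
          omega
      | mid ρ' => cases t <;> simp [RailGadget.relB] at huv
      | port r' t' => cases t <;> simp [RailGadget.relB] at huv
  · rintro (⟨r, hr, h⟩ | ⟨ρ, hρ, h⟩)
    · rcases mem_railEdgesN_iff.1 h with h | ⟨i, hi, h⟩ | h <;>
        (simp only [Prod.mk.injEq] at h; obtain ⟨rfl, rfl⟩ := h)
      · -- the top port edge
        refine ⟨port ⟨r, hr⟩ true, node (⟨r, hr⟩, ⟨0, by omega⟩), by simp [RailGadget.relB], ?_, ?_⟩
        · simp only [RailPlacement.embFun, endsN, dif_pos hr]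
        · simp [RailPlacement.embFun]
      · -- a rail edge
        refine ⟨node (⟨r, hr⟩, ⟨i, by omega⟩), node (⟨r, hr⟩, ⟨i + 1, hi⟩), by simp [RailGadget.relB], ?_, ?_⟩
        · simp [RailPlacement.embFun, Nat.add_assoc]
        · simp only [RailPlacement.embFun]; ring
      · -- the bottom port edge
        refine ⟨port ⟨r, hr⟩ false, node (⟨r, hr⟩, ⟨P.K - 1, by omega⟩), ?_, ?_, ?_⟩
        · simp only [RailGadget.relB, Bool.and_eq_true, beq_iff_eq, true_and]; omega
        · simp only [RailPlacement.embFun, endsN, dif_pos hr]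
        · simp only [RailPlacement.embFun]; omega
    · rcases h with h | h <;> (simp only [Prod.mk.injEq] at h; obtain ⟨rfl, rfl⟩ := h)
      · refine ⟨mid ⟨ρ, hρ⟩, node (P.Γ.fst ⟨ρ, hρ⟩), by simp [RailGadget.relB], rfl, ?_⟩
        simp only [RailPlacement.embFun, fstN, dif_pos hρ]
      · refine ⟨mid ⟨ρ, hρ⟩, node (P.Γ.snd ⟨ρ, hρ⟩), by simp [RailGadget.relB], rfl, ?_⟩
        simp only [RailPlacement.embFun, sndN, dif_pos hρ]

/-- The edge relation of a template is irreflexive. [folklore] -/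
theorem relB_irrefl {k K m : ℕ} (Γ : RailGadget k K m) (u : RailV k K m) : Γ.relB u u = false := by
  cases u with
  | node x => simp [RailGadget.relB]
  | mid ρ => simp [RailGadget.relB]
  | port r t => cases t <;> simp [RailGadget.relB]

/-- **Adjacency of a placed rail gadget is membership in its edge list** (in either order).
[folklore] -/
theorem gx_adj_iff {a b : ℕ} : P.GX.Adj a b ↔ (a, b) ∈ rpEdges P ∨ (b, a) ∈ rpEdges P := by
  rw [RailPlacement.GX, _root_.SimpleGraph.map_adj]
  simp only [emb_apply]
  rw [← relB_iff_mem_rpEdges, ← relB_iff_mem_rpEdges]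
  constructor
  · rintro ⟨u, v, huv, rfl, rfl⟩
    rcases (P.Γ.adj_iff.1 huv).2 with h | h
    · exact Or.inl ⟨u, v, h, rfl, rfl⟩
    · exact Or.inr ⟨v, u, h, rfl, rfl⟩
  · rintro (⟨u, v, h, rfl, rfl⟩ | ⟨v, u, h, rfl, rfl⟩)
    · refine ⟨u, v, P.Γ.adj_iff.2 ⟨?_, Or.inl h⟩, rfl, rfl⟩
      rintro rfl; rw [relB_irrefl] at h; exact Bool.false_ne_true h
    · refine ⟨u, v, P.Γ.adj_iff.2 ⟨?_, Or.inr h⟩, rfl, rfl⟩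
      rintro rfl; rw [relB_irrefl] at h; exact Bool.false_ne_true h

end RailPlacementLists

/-! ### The chain of cells as lists -/

section ChainLists

variable (ψ : CNF ℕ)

/-- The edges of cell `kc` of type `ty`, numbered. [folklore] -/
def cellEdgesN (kc : ℕ) (ty : CellTy) : List (ℕ × ℕ) := ty.edgeList.map fun e => (vtx kc e.1, vtx kc e.2)

/-- **The edge list of the chain of cells of `ψ`**: per cell, the connector edge `conn kc – P`, the
cell edges, and the edge `Q – conn (kc+1)` to the next connector (absent at the last cell). [folklore] -/
def chainEdgesN : List (ℕ × ℕ) :=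
  (List.range (ncells ψ)).flatMap fun kc =>
    (conn kc, vtx kc (cellTyAt ψ kc).pIdx) :: cellEdgesN kc (cellTyAt ψ kc) ++
      (if kc + 1 < ncells ψ then [(vtx kc (cellTyAt ψ kc).qIdx, conn (kc + 1))] else [])

/-- **The vertex list of the chain of cells of `ψ`**: per cell, the connector and the block. [folklore] -/
def chainVertsN : List ℕ :=
  (List.range (ncells ψ)).flatMap fun kc => conn kc :: (cellTyAt ψ kc).vertList.map (vtx kc)

/-- The cell types of the chain of `ψ` (total form). [folklore] -/
theorem cellTy_cellsOf' (kc : ℕ) (hk : kc < ncells ψ) : cellTy (cellsOf ψ) kc = cellTyAt ψ kc :=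
  cellTy_cellsOf ψ hk

/-- Boolean cell adjacency is membership in the edge list, in either order. [folklore] -/
theorem adjB_iff_mem (ty : CellTy) (a b : Fin 16) :
    ty.adjB a b = true ↔ (a, b) ∈ ty.edgeList ∨ (b, a) ∈ ty.edgeList := by
  simp [CellTy.adjB]

/-- Members of `cellEdgesN`. [folklore] -/
theorem mem_cellEdgesN_iff {kc : ℕ} {ty : CellTy} {e : ℕ × ℕ} :
    e ∈ cellEdgesN kc ty ↔ ∃ a b, (a, b) ∈ ty.edgeList ∧ e = (vtx kc a, vtx kc b) := by
  unfold cellEdgesN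
  rw [List.mem_map]
  constructor
  · rintro ⟨⟨a, b⟩, h, rfl⟩; exact ⟨a, b, h, rfl⟩
  · rintro ⟨a, b, h, rfl⟩; exact ⟨(a, b), h, rfl⟩

/-- Members of `chainEdgesN`. [folklore] -/
theorem mem_chainEdgesN_iff {e : ℕ × ℕ} :
    e ∈ chainEdgesN ψ ↔ ∃ kc < ncells ψ,
      e = (conn kc, vtx kc (cellTyAt ψ kc).pIdx) ∨ e ∈ cellEdgesN kc (cellTyAt ψ kc) ∨
        (kc + 1 < ncells ψ ∧ e = (vtx kc (cellTyAt ψ kc).qIdx, conn (kc + 1))) := by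
  unfold chainEdgesN
  simp only [List.mem_flatMap, List.mem_range, List.cons_append, List.mem_cons, List.mem_append]
  constructor
  · rintro ⟨kc, hk, h | h | h⟩
    · exact ⟨kc, hk, Or.inl h⟩
    · exact ⟨kc, hk, Or.inr (Or.inl h)⟩
    · refine ⟨kc, hk, Or.inr (Or.inr ?_)⟩
      split_ifs at h with h1
      · exact ⟨h1, List.mem_singleton.1 h⟩
      · simp at h
  · rintro ⟨kc, hk, h | h | ⟨h1, h⟩⟩
    · exact ⟨kc, hk, Or.inl h⟩
    · exact ⟨kc, hk, Or.inr (Or.inl h)⟩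
    · exact ⟨kc, hk, Or.inr (Or.inr (by rw [if_pos h1]; exact List.mem_singleton.2 h))⟩

/-- **The directed edge relation of the chain of `ψ` is membership in the edge list**, up to the
orientation of cell edges. [folklore] -/
theorem rel_iff_mem {u v : ℕ} :
    GridCell.Rel (cellsOf ψ) u v ↔ (u, v) ∈ chainEdgesN ψ ∨
      (∃ kc < ncells ψ, ∃ a b, (b, a) ∈ (cellTyAt ψ kc).edgeList ∧ u = vtx kc a ∧ v = vtx kc b) := by
  rw [mem_chainEdgesN_iff]
  unfold GridCell.Rel
  simp only [length_cellsOf]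
  constructor
  · rintro (⟨kc, hk, a, b, hab, rfl, rfl⟩ | ⟨kc, hk, rfl, rfl⟩ | ⟨kc, hk, rfl, rfl⟩)
    · rw [cellTy_cellsOf' ψ kc hk, adjB_iff_mem] at hab
      rcases hab with hab | hab
      · exact Or.inl ⟨kc, hk, Or.inr (Or.inl (mem_cellEdgesN_iff.2 ⟨a, b, hab, rfl⟩))⟩
      · exact Or.inr ⟨kc, hk, a, b, hab, rfl, rfl⟩
    · rw [cellTy_cellsOf' ψ kc hk]
      exact Or.inl ⟨kc, hk, Or.inl rfl⟩
    · rw [cellTy_cellsOf' ψ kc (by omega)]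
      exact Or.inl ⟨kc, by omega, Or.inr (Or.inr ⟨hk, rfl⟩)⟩
  · rintro (⟨kc, hk, h | h | ⟨h1, h⟩⟩ | ⟨kc, hk, a, b, hab, rfl, rfl⟩)
    · refine Or.inr (Or.inl ⟨kc, hk, ?_⟩)
      rw [cellTy_cellsOf' ψ kc hk]
      simpa [Prod.mk.injEq] using h
    · obtain ⟨a, b, hab, h⟩ := mem_cellEdgesN_iff.1 h
      simp only [Prod.mk.injEq] at h
      obtain ⟨rfl, rfl⟩ := h
      refine Or.inl ⟨kc, hk, a, b, ?_, rfl, rfl⟩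
      rw [cellTy_cellsOf' ψ kc hk, adjB_iff_mem]
      exact Or.inl hab
    · refine Or.inr (Or.inr ⟨kc, h1, ?_⟩)
      rw [cellTy_cellsOf' ψ kc hk]
      simpa [Prod.mk.injEq] using h
    · refine Or.inl ⟨kc, hk, a, b, ?_, rfl, rfl⟩
      rw [cellTy_cellsOf' ψ kc hk, adjB_iff_mem]
      exact Or.inr hab

/-- **Adjacency in the chain of cells of `ψ` is membership in the edge list** (either order).
[folklore] -/
theorem chainG_adj_iff_mem {u v : ℕ} :
    (chainG (cellsOf ψ)).Adj u v ↔ (u, v) ∈ chainEdgesN ψ ∨ (v, u) ∈ chainEdgesN ψ := by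
  rw [GridCell.chainG_adj, rel_iff_mem, rel_iff_mem]
  constructor
  · rintro ⟨-, (h | ⟨kc, hk, a, b, hab, rfl, rfl⟩) | (h | ⟨kc, hk, a, b, hab, rfl, rfl⟩)⟩
    · exact Or.inl h
    · exact Or.inr ((mem_chainEdgesN_iff ψ).2 ⟨kc, hk, Or.inr (Or.inl (mem_cellEdgesN_iff.2 ⟨b, a, hab, rfl⟩))⟩)
    · exact Or.inr h
    · exact Or.inl ((mem_chainEdgesN_iff ψ).2 ⟨kc, hk, Or.inr (Or.inl (mem_cellEdgesN_iff.2 ⟨b, a, hab, rfl⟩))⟩)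
  · intro h
    have hne : u ≠ v := by
      have key : ∀ {x y : ℕ}, (x, y) ∈ chainEdgesN ψ → x ≠ y := by
        intro x y hxy
        obtain ⟨kc, hk, h | h | ⟨-, h⟩⟩ := (mem_chainEdgesN_iff ψ).1 hxy
        · simp only [Prod.mk.injEq] at h
          rw [h.1, h.2]
          exact (GridCell.vtx_ne_conn _ _ _).symm
        · obtain ⟨a, b, hab, h⟩ := mem_cellEdgesN_iff.1 h
          simp only [Prod.mk.injEq] at h
          rw [h.1, h.2]
          intro hv
          have hab' : (cellTyAt ψ kc).adjB a b = true := (adjB_iff_mem _ a b).2 (Or.inl hab)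
          rw [(GridCell.vtx_inj.1 hv).2, CellTy.adjB_irrefl] at hab'
          exact Bool.false_ne_true hab'
        · simp only [Prod.mk.injEq] at h
          rw [h.1, h.2]
          exact GridCell.vtx_ne_conn _ _ _
      rcases h with h | h
      · exact key h
      · exact (key h).symm
    rcases h with h | h
    · exact ⟨hne, Or.inl (Or.inl h)⟩
    · exact ⟨hne, Or.inr (Or.inl h)⟩

/-- **Membership in the chain's vertex set is membership in the vertex list.** [folklore] -/
theorem mem_chainVertsN_iff {v : ℕ} : v ∈ chainVertsN ψ ↔ v ∈ chainVerts (cellsOf ψ) := by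
  unfold chainVertsN
  rw [GridCell.mem_chainVerts]
  simp only [List.mem_flatMap, List.mem_range, List.mem_cons, List.mem_map, length_cellsOf]
  constructor
  · rintro ⟨kc, hk, h | ⟨j, hj, rfl⟩⟩
    · exact ⟨kc, hk, Or.inl h⟩
    · refine ⟨kc, hk, Or.inr ?_⟩
      rw [cellTy_cellsOf' ψ kc hk]
      exact GridCell.mem_blockVerts.2 ⟨j, hj, rfl⟩
  · rintro ⟨kc, hk, h | h⟩
    · exact ⟨kc, hk, Or.inl h⟩
    · rw [cellTy_cellsOf' ψ kc hk] at h
      obtain ⟨j, hj, rfl⟩ := GridCell.mem_blockVerts.1 h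
      exact ⟨kc, hk, Or.inr ⟨j, hj, rfl⟩⟩

end ChainLists

/-! ### The whole graph as lists -/

section GraphLists

variable (ψ : CNF ℕ)

/-- The vertex list of gadget `g` (empty if not placed). [folklore] -/
def placeVerts (g : ℕ) : List ℕ := (place ψ g).elim [] rpVerts

/-- The slot list of gadget `g` (empty if not placed). [folklore] -/
def placeSlots (g : ℕ) : List (ℕ × ℕ) := (place ψ g).elim [] rpSlots

/-- The edge list of gadget `g` (empty if not placed). [folklore] -/
def placeEdges (g : ℕ) : List (ℕ × ℕ) := (place ψ g).elim [] rpEdges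

/-- **All slots of the gadget family of `ψ`.** [folklore] -/
def slotsOf : List (ℕ × ℕ) := (List.range (ngadgets ψ)).flatMap (placeSlots ψ)

/-- **The vertex list of the graph of `ψ`**: the chain's vertices, then every gadget's block. [folklore] -/
def vertsListOf : List ℕ := chainVertsN ψ ++ (List.range (ngadgets ψ)).flatMap (placeVerts ψ)

/-- **The edge list of the graph of `ψ`**: the chain edges that are not slots (in either
orientation), then every gadget's edges. [folklore] -/
def edgesOf : List (ℕ × ℕ) :=
  (chainEdgesN ψ).filter (fun e => decide (e ∉ slotsOf ψ ∧ e.swap ∉ slotsOf ψ)) ++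
    (List.range (ngadgets ψ)).flatMap (placeEdges ψ)

/-- Membership in the slots of gadget `g`. [folklore] -/
theorem mem_placeSlots_iff {g : ℕ} {e : ℕ × ℕ} : e ∈ placeSlots ψ g ↔ e ∈ (family ψ).S g := by
  rw [placeSlots, family_S]
  cases place ψ g with
  | none => simp
  | some P => exact mem_rpSlots_iff P

/-- Membership in the vertex block of gadget `g`. [folklore] -/
theorem mem_placeVerts_iff {g : ℕ} {v : ℕ} : v ∈ placeVerts ψ g ↔ v ∈ (family ψ).VX g := by
  rw [placeVerts, family_VX]
  cases place ψ g with
  | none => simp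
  | some P => exact mem_rpVerts_iff P

/-- **Adjacency in the gadget graph of gadget `g` is membership in its edge list.** [folklore] -/
theorem gadget_adj_iff_mem {g : ℕ} {a b : ℕ} :
    ((family ψ).GX g).Adj a b ↔ (a, b) ∈ placeEdges ψ g ∨ (b, a) ∈ placeEdges ψ g := by
  rw [placeEdges, family_GX]
  cases place ψ g with
  | none => simp
  | some P => exact gx_adj_iff P

/-- Membership in `slotsOf`. [folklore] -/
theorem mem_slotsOf_iff {e : ℕ × ℕ} : e ∈ slotsOf ψ ↔ ∃ g < ngadgets ψ, e ∈ (family ψ).S g := by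
  unfold slotsOf
  simp only [List.mem_flatMap, List.mem_range, mem_placeSlots_iff]

/-- Being a slot of one of the gadgets, through `slotsOf`. [folklore] -/
theorem exists_slotOf_iff {a b : ℕ} :
    (∃ g < ngadgets ψ, slotOf ((family ψ).S g) a b) ↔ (a, b) ∈ slotsOf ψ ∨ (b, a) ∈ slotsOf ψ := by
  simp only [slotOf, mem_slotsOf_iff]
  constructor
  · rintro ⟨g, hg, h | h⟩
    · exact Or.inl ⟨g, hg, h⟩
    · exact Or.inr ⟨g, hg, h⟩
  · rintro (⟨g, hg, h⟩ | ⟨g, hg, h⟩)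
    · exact ⟨g, hg, Or.inl h⟩
    · exact ⟨g, hg, Or.inr h⟩

/-- **The vertex set of the graph of `ψ` is the vertex list.** [folklore] -/
theorem mem_vertsUpTo_iff_mem {a : ℕ} :
    a ∈ GadgetFamily.vertsUpTo (chainVerts (cellsOf ψ)) (family ψ) (ngadgets ψ) ↔ a ∈ vertsListOf ψ := by
  rw [GadgetFamily.mem_vertsUpTo_iff, vertsListOf, List.mem_append, mem_chainVertsN_iff]
  simp only [List.mem_flatMap, List.mem_range, mem_placeVerts_iff]

/-- **Adjacency in the graph of `ψ` is membership in the edge list** (either order). [folklore] -/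
theorem graphUpTo_adj_iff_mem {a b : ℕ} :
    (GadgetFamily.graphUpTo (chainG (cellsOf ψ)) (chainVerts (cellsOf ψ)) (family ψ) (ngadgets ψ)).Adj a b ↔
      (a, b) ∈ edgesOf ψ ∨ (b, a) ∈ edgesOf ψ := by
  have hslots : (∀ g < ngadgets ψ, ¬ slotOf ((family ψ).S g) a b) ↔ ¬ ((a, b) ∈ slotsOf ψ ∨ (b, a) ∈ slotsOf ψ) := by
    rw [← exists_slotOf_iff]; simp
  show ((chainG (cellsOf ψ)).Adj a b ∧ a ∈ chainVerts (cellsOf ψ) ∧ b ∈ chainVerts (cellsOf ψ) ∧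
      ∀ g < ngadgets ψ, ¬ slotOf ((family ψ).S g) a b) ∨ (∃ g < ngadgets ψ, ((family ψ).GX g).Adj a b) ↔ _
  rw [hslots, edgesOf]
  simp only [List.mem_append, List.mem_filter, List.mem_flatMap, List.mem_range, decide_eq_true_eq, Prod.swap_prod_mk,
    gadget_adj_iff_mem]
  constructor
  · rintro (⟨hadj, -, -, hns⟩ | ⟨g, hg, h | h⟩)
    · rw [not_or] at hns
      rcases (chainG_adj_iff_mem ψ).1 hadj with h | h
      · exact Or.inl (Or.inl ⟨h, hns.1, hns.2⟩)
      · exact Or.inr (Or.inl ⟨h, hns.2, hns.1⟩)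
    · exact Or.inl (Or.inr ⟨g, hg, h⟩)
    · exact Or.inr (Or.inr ⟨g, hg, h⟩)
  · rintro ((⟨h, h1, h2⟩ | ⟨g, hg, h⟩) | (⟨h, h1, h2⟩ | ⟨g, hg, h⟩))
    · have hadj := (chainG_adj_iff_mem ψ).2 (Or.inl h)
      have hm := GridCell.mem_chainVerts_of_adj hadj
      exact Or.inl ⟨hadj, hm.1, hm.2, not_or.2 ⟨h1, h2⟩⟩
    · exact Or.inr ⟨g, hg, Or.inl h⟩
    · have hadj := (chainG_adj_iff_mem ψ).2 (Or.inr h)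
      have hm := GridCell.mem_chainVerts_of_adj hadj
      exact Or.inl ⟨hadj, hm.1, hm.2, not_or.2 ⟨h2, h1⟩⟩
    · exact Or.inr ⟨g, hg, Or.inr h⟩

/-- **The vertex set `vertsOf ψ` of the graph of `ψ` is the vertex list.** [folklore] -/
theorem mem_vertsOf_iff {a : ℕ} : a ∈ vertsOf ψ ↔ a ∈ vertsListOf ψ := mem_vertsUpTo_iff_mem ψ

/-- **Adjacency in `graphOf ψ` is membership in the edge list** (either order).
[cite: LiskiewiczOgiharaToda2003, §3 (proof of Lemma 4: the graph `G` of the reduction)] -/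
theorem graphOf_adj_iff {a b : ℕ} : (graphOf ψ).Adj a b ↔ (a, b) ∈ edgesOf ψ ∨ (b, a) ∈ edgesOf ψ :=
  graphUpTo_adj_iff_mem ψ

/-- Adjacency in `graphOf ψ` is decidable (through the edge list). [folklore] -/
instance : DecidableRel (graphOf ψ).Adj := fun _ _ => decidable_of_iff _ (graphOf_adj_iff ψ).symm

/-- **Edges of `graphOf ψ` join vertices of `vertsOf ψ`** (the family is valid: gadget edges attach
to the block or to ports, which are chain vertices). [folklore] -/
theorem mem_vertsOf_of_adj {a b : ℕ} (h : (graphOf ψ).Adj a b) : a ∈ vertsOf ψ ∧ b ∈ vertsOf ψ := by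
  have hv := valid ψ (ngadgets ψ)
  change (GadgetFamily.graphUpTo (chainG (cellsOf ψ)) (chainVerts (cellsOf ψ)) (family ψ) (ngadgets ψ)).Adj a b at h
  change a ∈ GadgetFamily.vertsUpTo (chainVerts (cellsOf ψ)) (family ψ) (ngadgets ψ) ∧
    b ∈ GadgetFamily.vertsUpTo (chainVerts (cellsOf ψ)) (family ψ) (ngadgets ψ)
  rcases h with ⟨-, ha, hb, -⟩ | ⟨g, hg, h⟩
  · exact ⟨GadgetFamily.mem_vertsUpTo_iff.2 (Or.inl ha), GadgetFamily.mem_vertsUpTo_iff.2 (Or.inl hb)⟩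
  · obtain ⟨-, ha, hb⟩ := hv.gadget_adj g hg a b h
    have hin : ∀ x, x ∈ (family ψ).VX g ∨ x ∈ ports ((family ψ).S g) →
        x ∈ GadgetFamily.vertsUpTo (chainVerts (cellsOf ψ)) (family ψ) (ngadgets ψ) := by
      rintro x (hx | hx)
      · exact GadgetFamily.mem_vertsUpTo_iff.2 (Or.inr ⟨g, hg, hx⟩)
      · exact GadgetFamily.mem_vertsUpTo_iff.2 (Or.inl (hv.ports_subset hg hx))
    exact ⟨hin a ha, hin b hb⟩

/-- **Listed edges join listed vertices.** [folklore] -/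
theorem mem_vertsListOf_of_mem_edgesOf {e : ℕ × ℕ} (h : e ∈ edgesOf ψ) : e.1 ∈ vertsListOf ψ ∧ e.2 ∈ vertsListOf ψ := by
  have := mem_vertsOf_of_adj ψ ((graphOf_adj_iff ψ).2 (Or.inl h))
  exact ⟨(mem_vertsOf_iff ψ).1 this.1, (mem_vertsOf_iff ψ).1 this.2⟩

/-- Listed edges are not loops. [folklore] -/
theorem ne_of_mem_edgesOf {e : ℕ × ℕ} (h : e ∈ edgesOf ψ) : e.1 ≠ e.2 :=
  ((graphOf ψ).ne_of_adj ((graphOf_adj_iff ψ).2 (Or.inl h)))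

end GraphLists

/-! ### The three placed templates, arithmetically -/

section Templates

variable (ψ : CNF ℕ)

/-- `rpEdgesN` depends on `ends` only below `k` and on `fstC`, `sndC` only below `m`. [folklore] -/
theorem rpEdgesN_congr {k K m base : ℕ} {ends ends' : ℕ → ℕ × ℕ} {fstC fstC' sndC sndC' : ℕ → ℕ}
    (he : ∀ r < k, ends r = ends' r) (hf : ∀ ρ < m, fstC ρ = fstC' ρ) (hs : ∀ ρ < m, sndC ρ = sndC' ρ) :
    rpEdgesN k K m base ends fstC sndC = rpEdgesN k K m base ends' fstC' sndC' := by
  unfold rpEdgesN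
  congr 1
  · refine List.flatMap_congr fun r hr => ?_
    rw [he r (List.mem_range.1 hr)]
  · refine List.flatMap_congr fun ρ hρ => ?_
    rw [hf ρ (List.mem_range.1 hρ), hs ρ (List.mem_range.1 hρ)]

/-- **The edges of a placed XOR-chord** (2 rails of 4 nodes, rung `ρ` joining the codes `ρ` and
`4 + ρ`) from `base`, between the slots `s₀`, `s₁`. [folklore] -/
def xorEdgesN (base : ℕ) (s₀ s₁ : ℕ × ℕ) : List (ℕ × ℕ) :=
  rpEdgesN 2 4 4 base (fun r => if r = 0 then s₀ else s₁) (fun ρ => ρ) (fun ρ => 4 + ρ)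

/-- **The edges of a placed one-input OR-gadget** (1 rail of 2 nodes, one rung `0 – 1`) on the slot
`s`. [folklore] -/
def or1EdgesN (base : ℕ) (s : ℕ × ℕ) : List (ℕ × ℕ) :=
  rpEdgesN 1 2 1 base (fun _ => s) (fun _ => 0) (fun _ => 1)

/-- Codes of the first ends of the nine rungs of the three-input OR-gadget (`RailOR3.fst`, rails of
six nodes). [folklore] -/
def or3FstC (ρ : ℕ) : ℕ := [1, 7, 13, 0, 2, 3, 4, 9, 10].getD ρ 0

/-- Codes of the second ends of the nine rungs of the three-input OR-gadget (`RailOR3.snd`). [folklore] -/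
def or3SndC (ρ : ℕ) : ℕ := [5, 11, 17, 16, 15, 8, 6, 14, 12].getD ρ 0

/-- **The edges of a placed three-input OR-gadget** (3 rails of 6 nodes, nine rungs) on the slots
`s₀, s₁, s₂`. [folklore] -/
def or3EdgesN (base : ℕ) (s₀ s₁ s₂ : ℕ × ℕ) : List (ℕ × ℕ) :=
  rpEdgesN 3 6 9 base (fun r => if r = 0 then s₀ else if r = 1 then s₁ else s₂) or3FstC or3SndC

/-- **The guard of a gadget specification**: it can be placed (cells exist and differ, slot ends
differ). [folklore] -/
def SpecOK : GadSpec → Prop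
  | .xor k₁ e₁ k₂ e₂ => k₁ < ncells ψ ∧ k₂ < ncells ψ ∧ k₁ ≠ k₂ ∧ e₁.1 ≠ e₁.2 ∧ e₂.1 ≠ e₂.2
  | .or1 k => k < ncells ψ
  | .or3 k => k + 2 < ncells ψ

/-- The guard is decidable. [folklore] -/
instance (s : GadSpec) : Decidable (SpecOK ψ s) := by
  cases s <;> unfold SpecOK <;> infer_instance

/-- The number of inner vertices of a specification: `12`, `3`, `27`. [folklore] -/
def specSize : GadSpec → ℕ
  | .xor _ _ _ _ => 12
  | .or1 _ => 3
  | .or3 _ => 27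

/-- The slots of a specification. [folklore] -/
def specSlots : GadSpec → List (ℕ × ℕ)
  | .xor k₁ e₁ k₂ e₂ => [gs k₁ e₁, gs k₂ e₂]
  | .or1 k => [gs k bS0]
  | .or3 k => [gs k bS0, gs (k + 1) bS0, gs (k + 2) bS0]

/-- The edges of a specification placed from `base`. [folklore] -/
def specEdges (base : ℕ) : GadSpec → List (ℕ × ℕ)
  | .xor k₁ e₁ k₂ e₂ => xorEdgesN base (gs k₁ e₁) (gs k₂ e₂)
  | .or1 k => or1EdgesN base (gs k bS0)
  | .or3 k => or3EdgesN base (gs k bS0) (gs (k + 1) bS0) (gs (k + 2) bS0)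

/-- The codes of `RailOR3.fst`. [folklore] -/
theorem or3_fst_code (ρ : Fin 9) : (RailOR3.Γ.fst ρ).1.val * 6 + (RailOR3.Γ.fst ρ).2.val = or3FstC ρ.val := by
  revert ρ; decide

/-- The codes of `RailOR3.snd`. [folklore] -/
theorem or3_snd_code (ρ : Fin 9) : (RailOR3.Γ.snd ρ).1.val * 6 + (RailOR3.Γ.snd ρ).2.val = or3SndC ρ.val := by
  revert ρ; decide

/-- **The vertex list of gadget `g`, explicitly**: the block of `specSize` numbers from `gbase ψ g`
if the specification can be placed. [folklore] -/
theorem placeVerts_eq (g : ℕ) :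
    placeVerts ψ g = (gad ψ g).elim [] fun s => if SpecOK ψ s then (List.range (specSize s)).map (fun i => gbase ψ g + i) else [] := by
  unfold placeVerts place
  cases gad ψ g with
  | none => rfl
  | some s =>
    cases s with
    | xor k₁ e₁ k₂ e₂ =>
      simp only [Option.bind_some, realize, Option.elim_some, SpecOK, specSize]
      unfold xorAt?
      split_ifs with hok <;> rfl
    | or1 k =>
      simp only [Option.bind_some, realize, Option.elim_some, SpecOK, specSize]
      unfold or1At?
      split_ifs with hok <;> rfl
    | or3 k =>
      simp only [Option.bind_some, realize, Option.elim_some, SpecOK, specSize]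
      unfold or3At?
      split_ifs with hok <;> rfl

/-- **The slot list of gadget `g`, explicitly.** [folklore] -/
theorem placeSlots_eq (g : ℕ) :
    placeSlots ψ g = (gad ψ g).elim [] fun s => if SpecOK ψ s then specSlots s else [] := by
  unfold placeSlots place
  cases gad ψ g with
  | none => rfl
  | some s =>
    cases s with
    | xor k₁ e₁ k₂ e₂ =>
      simp only [Option.bind_some, realize, Option.elim_some, SpecOK, specSlots]
      unfold xorAt?
      split_ifs with hok
      · simp [rpSlots, endsN, List.range_succ]
      · rfl
    | or1 k =>
      simp only [Option.bind_some, realize, Option.elim_some, SpecOK, specSlots]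
      unfold or1At?
      split_ifs with hok
      · simp [rpSlots, endsN, List.range_succ]
      · rfl
    | or3 k =>
      simp only [Option.bind_some, realize, Option.elim_some, SpecOK, specSlots]
      unfold or3At?
      split_ifs with hok
      · simp [rpSlots, endsN, List.range_succ]
      · rfl

/-- **The edge list of gadget `g`, explicitly.** [folklore] -/
theorem placeEdges_eq (g : ℕ) :
    placeEdges ψ g = (gad ψ g).elim [] fun s => if SpecOK ψ s then specEdges (gbase ψ g) s else [] := by
  unfold placeEdges place
  cases gad ψ g with
  | none => rfl
  | some s =>
    cases s with
    | xor k₁ e₁ k₂ e₂ =>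
      simp only [Option.bind_some, realize, Option.elim_some, SpecOK, specEdges]
      unfold xorAt?
      split_ifs with hok
      · simp only [Option.elim_some, rpEdges, xorEdgesN]
        refine rpEdgesN_congr (fun r hr => ?_) (fun ρ hρ => ?_) (fun ρ hρ => ?_)
        · simp only [endsN, dif_pos hr, Fin.ext_iff, Fin.val_zero]
        · simp only [fstN, dif_pos hρ]; simp [RailXOR.Γ, RailXOR.fst]
        · simp only [sndN, dif_pos hρ]; simp [RailXOR.Γ, RailXOR.snd]
      · rfl
    | or1 k =>
      simp only [Option.bind_some, realize, Option.elim_some, SpecOK, specEdges]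
      unfold or1At?
      split_ifs with hok
      · simp only [Option.elim_some, rpEdges, or1EdgesN]
        refine rpEdgesN_congr (fun r hr => ?_) (fun ρ hρ => ?_) (fun ρ hρ => ?_)
        · simp only [endsN, dif_pos hr]
        · simp only [fstN, dif_pos hρ]; simp [RailOR1.Γ]
        · simp only [sndN, dif_pos hρ]; simp [RailOR1.Γ]
      · rfl
    | or3 k =>
      simp only [Option.bind_some, realize, Option.elim_some, SpecOK, specEdges]
      unfold or3At?
      split_ifs with hok
      · simp only [Option.elim_some, rpEdges, or3EdgesN]
        refine rpEdgesN_congr (fun r hr => ?_) (fun ρ hρ => ?_) (fun ρ hρ => ?_)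
        · simp only [endsN, dif_pos hr]
          have : r = 0 ∨ r = 1 ∨ r = 2 := by omega
          rcases this with rfl | rfl | rfl <;> rfl
        · simp only [fstN, dif_pos hρ]; exact or3_fst_code ⟨ρ, hρ⟩
        · simp only [sndN, dif_pos hρ]; exact or3_snd_code ⟨ρ, hρ⟩
      · rfl

end Templates

end GridFormulaFP

end Literature.Barriers.CriticalPhenomena.GridSAW
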